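import Summits.ResolutionOfSingularities.ResolutionOfSingularities.Theorems.FrobeniusLadderFInjectiveMacaulayficationProp44Assembly
import Literature.AlgebraicGeometry.Resolution.IdealisticExponentResolution
import HarnessLib

/-!
# Cossart–Piltant 2019 principalization (`CossartPiltant2019Principalization`, F-77) from Prop. 4.4 (F-71)

OURS (res-inputs-p-8b g2; critic R130 (2)). The tree's reduction `CossartPiltant2019Principalization_holds_of : CossartPiltant2008_prop44 → …`
(`IdealisticExponentResolution.lean`) applied to the sorry-free assembly `CP2008Prop44.cossartPiltant2008_prop44_holds`
(`…Prop44Assembly.lean`). AI-written; AI review weaker than expert review. This proves the TREE's Lean statement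
`Literature.AlgebraicGeometry.Resolution.CossartPiltant2019Principalization` and nothing else; resolution in dimension `≥ 4` / positive
characteristic is NOT proved; no statement of a manuscript under adjudication is proved.
-/

-- `Summit.<Summit>.<Sub>.Theorems` with `Sub = Summit` (single-conjunct summit, D-0017)
set_option linter.dupNamespace false

noncomputable section

open Literature.AlgebraicGeometry.Resolution

namespace Summit.ResolutionOfSingularities.ResolutionOfSingularities.Theorems

namespace CP2008Prop44

universe u

/-- **F-77: the Cossart–Piltant 2019 principalization statement of the tree HOLDS** — from F-71 (`cossartPiltant2008_prop44_holds`) by the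
landed reduction `CossartPiltant2019Principalization_holds_of`. [cite: CossartPiltant2019, Thm. 1.1] [cite: CossartPiltant2008, Prop. 4.4] -/
theorem CossartPiltant2019Principalization_holds : CossartPiltant2019Principalization.{u} :=
  CossartPiltant2019Principalization_holds_of cossartPiltant2008_prop44_holds

end CP2008Prop44

end Summit.ResolutionOfSingularities.ResolutionOfSingularities.Theorems

end
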